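import Literature.NumberTheory.Automorphic.UnitaryIsotropicCharactersDet
import HarnessLib

/-!
# The abelianization of an isotropic unitary group: `U(J)′ = SU(J)` and `U(J) ∕ SU(J) ≅ N¹(σ)` via `det`

Topic `NumberTheory/Automorphic`; namespace `Literature.NumberTheory.Automorphic.UnitaryIsotropic`.  KERNEL only
(theorems, no definition, no notation, no instance, no named fact, no `sorry`).  Sequel of
✔ `Automorphic/UnitaryIsotropicCharactersDet` (`UnitaryIsotropic.apply_eq_one_of_det_eq_one`: for a field `K` with `2 ≠ 0`,
an involution `σ` with `σ θ₀ = −θ₀ ≠ 0`, and a non-degenerate `σ`-hermitian matrix `J` of ANY finite size admitting an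
isotropic vector, every homomorphism `unitaryGroupOfForm σ J →* A` to a commutative group kills `{det = 1}`), which it turns into
the STRUCTURE THEOREM it implies [Dieudonne1971GroupesClassiques, Chap. II §5: `U_n(K, f)′ = SU_n(K, f)` and
`U_n ∕ SU_n ≅` the group of determinants, for hermitian forms of index `≥ 1` over a commutative field]:

* §1 **`sigma_det_mul_det`** — `σ(det g) · det g = 1` for every `g ∈ U(J)` (`det J ≠ 0`; any commutative setting).
* §2 (matrix dress, private) the sesquilinear form `B_J x y = ᵗσ(x) J y` of `J` is hermitian and non-degenerate, `U(J)` is the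
  group of its isometries (`Matrix.toLin'`), an `End`-level isometry is represented by a member of `U(J)`; a non-zero
  non-degenerate hermitian space has an ANISOTROPIC vector (`σ ≠ 1`, `2 ≠ 0`).
* §3 **`exists_det_eq`** — `det : U(J) → N¹(σ) = {u : σu · u = 1}` is ONTO for EVERY non-degenerate `σ`-hermitian `J` of
  non-zero size (isotropic or not): the quasi-symmetry `Q(a, u) = 1 + ((u − 1)/B a a)·(B a) ⊗ a` along an anisotropic `a` is an
  isometry of determinant `u` (✔ `quasi_isometry`, ✔ `det_quasi`); hence **`mem_range_det_iff`**: the range of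
  `det : U(J) →* Kˣ` is exactly `N¹(σ)`.
* §4 **`commutator_eq_ker_det`** — for `J` ISOTROPIC: the commutator subgroup of `U(J)` IS the determinant-one subgroup
  `SU(J) = ker det` (`≤`: `det` is a homomorphism to the commutative group `Kˣ`; `≥`: the engine applied to
  `Abelianization.of`); **`mem_commutator_iff_det_eq_one`**.
* §5 consequences for characters: **`apply_eq_of_det_eq`** (a homomorphism to a commutative group depends on `det` only),
  **`existsUnique_eq_comp_rangeRestrict_det`** (it factors UNIQUELY through `det : U(J) ↠ det(U(J)) = N¹(σ)`), and
  **`bijective_abelianizationLift_det`** (`U(J)^{ab} → N¹(σ)`, `[g] ↦ det g`, is a group ISOMORPHISM).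
* §6 hypothesis forms for a matrix `M` propositionally equal to `J` (the shape of the tree's local unitary groups).

Written for the pub-hodgecm2 (COR-CM) audit of [Liu2021, App. D Lemma D.1 (3)] (characters of `U(V)(F_v)` ↔ characters of
`E_v¹`; seat prover-pub-hodgecm2-b10); nothing here is specific to number fields.  HC_CM is NOT proved.

## References

* J. Dieudonné, *La géométrie des groupes classiques*, 3e éd., Springer (1971), Chap. II §§4–5
  [Dieudonne1971GroupesClassiques].
-/

set_option autoImplicit false

namespace Literature.NumberTheory.Automorphic

namespace UnitaryIsotropic

variable {K : Type*} [Field K] {σ : K →+* K}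

/-! ## §1 `det` of a unitary matrix is `σ`-norm-one -/

section DetNormOne

variable {n : Type*} [Fintype n] [DecidableEq n]

/-- **`σ(det g) · det g = 1` for `g ∈ U(J)`** (`det J ≠ 0`): take determinants in `ᵗσ(g) J g = J`.
[cite: Dieudonne1971GroupesClassiques, Chap. II §5] -/
theorem sigma_det_mul_det (J : Matrix n n K) (hJdet : J.det ≠ 0) (g : ↥(unitaryGroupOfForm σ J)) :
    σ g.1.1.det * g.1.1.det = 1 := by
  have h := congrArg Matrix.det (mem_unitaryGroupOfForm_iff.1 g.2)
  rw [Matrix.det_mul, Matrix.det_mul, Matrix.det_transpose, ← RingHom.mapMatrix_apply, ← RingHom.map_det] at h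
  have h' : σ g.1.1.det * g.1.1.det * J.det = 1 * J.det := by linear_combination h
  exact mul_right_cancel₀ hJdet h'

/-- Unit form: `σ(det g) · det g = 1` for the `Kˣ`-valued determinant `Matrix.GeneralLinearGroup.det`.
[cite: Dieudonne1971GroupesClassiques, Chap. II §5] -/
theorem sigma_det_mul_det_units (J : Matrix n n K) (hJdet : J.det ≠ 0) (g : ↥(unitaryGroupOfForm σ J)) :
    σ ((Matrix.GeneralLinearGroup.det g.1 : Kˣ) : K) * (Matrix.GeneralLinearGroup.det g.1 : Kˣ) = 1 := by
  rw [Matrix.GeneralLinearGroup.val_det_apply]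
  exact sigma_det_mul_det J hJdet g

end DetNormOne

/-! ## §2 Matrix dress (private): the form `B_J`, isometries versus members of `U(J)`, anisotropic vectors -/

section Abstract

variable {V : Type*} [AddCommGroup V] [Module K V]

/-- A non-zero non-degenerate hermitian space (involution with `σ θ₀ = −θ₀ ≠ 0`, `2 ≠ 0`) has an anisotropic vector
(copy of the engine's private lemma). [folklore] -/
private theorem exists_anisotropic (B : V →ₛₗ[σ] V →ₗ[K] K) (hB : ∀ x y, σ (B x y) = B y x)
    (hBnd : ∀ x, (∀ y, B x y = 0) → x = 0) {θ₀ : K} (hθ : σ θ₀ = -θ₀) (hθ0 : θ₀ ≠ 0) (h2 : (2 : K) ≠ 0)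
    (hne : ∃ w : V, w ≠ 0) : ∃ a : V, B a a ≠ 0 := by
  by_contra hall
  push Not at hall
  obtain ⟨w, hw⟩ := hne
  refine hw (hBnd w fun y => ?_)
  have h1 := hall (w + y)
  have h2' := hall (θ₀ • w + y)
  simp only [map_add, LinearMap.map_smulₛₗ, map_smul, LinearMap.add_apply, LinearMap.smul_apply, smul_eq_mul, hall w,
    hall y, hθ, (hB w y).symm] at h1 h2'
  have : (2 * θ₀) * B w y = 0 := by linear_combination θ₀ * h1 - h2'
  exact (mul_eq_zero.1 this).resolve_left (mul_ne_zero h2 hθ0)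

end Abstract

section MatrixForm

variable {n : Type*} [Fintype n] [DecidableEq n]

/-- The sesquilinear form of `J`: `B_J x y = ᵗσ(x) J y` (copy of the engine's private lemma). [folklore] -/
private theorem toLinearMapₛₗ₂'_apply_eq (J : Matrix n n K) (x y : n → K) :
    Matrix.toLinearMapₛₗ₂' K σ (RingHom.id K) J x y = dotProduct (fun i => σ (x i)) (J.mulVec y) := by
  rw [Matrix.toLinearMapₛₗ₂'_apply]
  simp only [RingHom.id_apply, smul_eq_mul, dotProduct, Matrix.mulVec, Finset.mul_sum]
  exact Finset.sum_congr rfl fun i _ => Finset.sum_congr rfl fun j _ => by ring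

/-- `B_J (M x) (M y) = ᵗσ(x) (ᵗσ(M) J M) y` (copy of the engine's private lemma). [folklore] -/
private theorem form_toLin' (J M : Matrix n n K) (x y : n → K) :
    Matrix.toLinearMapₛₗ₂' K σ (RingHom.id K) J (Matrix.toLin' M x) (Matrix.toLin' M y) =
      dotProduct (fun i => σ (x i)) (((M.map σ).transpose * J * M).mulVec y) := by
  rw [toLinearMapₛₗ₂'_apply_eq, Matrix.toLin'_apply, Matrix.toLin'_apply]
  have h1 : (fun i => σ ((M.mulVec x) i)) = (M.map σ).mulVec (fun i => σ (x i)) := by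
    funext i
    rw [RingHom.map_mulVec]
    rfl
  rw [h1, ← Matrix.vecMul_transpose, ← Matrix.dotProduct_mulVec, Matrix.mulVec_mulVec, Matrix.mulVec_mulVec]

omit [Fintype n] in
/-- `σ` applied to a basis vector `Pi.single i 1` gives it back (copy of the engine's private lemma). [folklore] -/
private theorem sigma_single (i : n) : (fun k => σ (Pi.single (M := fun _ => K) i (1 : K) k)) = Pi.single i 1 := by
  funext k
  by_cases h : k = i
  · subst h; rw [Pi.single_eq_same, map_one]
  · rw [Pi.single_eq_of_ne h, map_zero]

/-- `B_J` is hermitian when `J` is (`σ` an involution). [folklore] -/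
private theorem form_hermitian (hσ : ∀ x : K, σ (σ x) = x) (J : Matrix n n K) (hJh : (J.map σ).transpose = J)
    (x y : n → K) :
    σ (Matrix.toLinearMapₛₗ₂' K σ (RingHom.id K) J x y) = Matrix.toLinearMapₛₗ₂' K σ (RingHom.id K) J y x := by
  have hJ' : ∀ i j, σ (J i j) = J j i := by
    intro i j
    have h := congrFun (congrFun hJh j) i
    rw [Matrix.transpose_apply, Matrix.map_apply] at h
    exact h
  rw [toLinearMapₛₗ₂'_apply_eq, toLinearMapₛₗ₂'_apply_eq]
  simp only [dotProduct, Matrix.mulVec, map_sum, map_mul, hσ, hJ', Finset.mul_sum]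
  rw [Finset.sum_comm]
  exact Finset.sum_congr rfl fun i _ => Finset.sum_congr rfl fun j _ => by ring

/-- `B_J` is non-degenerate when `det J ≠ 0` (`σ` an involution). [folklore] -/
private theorem form_nondegenerate (hσ : ∀ x : K, σ (σ x) = x) (J : Matrix n n K) (hJdet : J.det ≠ 0) (x : n → K)
    (hx : ∀ y, Matrix.toLinearMapₛₗ₂' K σ (RingHom.id K) J x y = 0) : x = 0 := by
  have hv : Matrix.vecMul (fun i => σ (x i)) J = 0 := by
    funext j
    have := hx (Pi.single j 1)
    rwa [toLinearMapₛₗ₂'_apply_eq, Matrix.dotProduct_mulVec, dotProduct_single, mul_one] at this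
  have h0 := Matrix.eq_zero_of_vecMul_eq_zero hJdet hv
  funext i
  have hi := congrFun h0 i
  simp only [Pi.zero_apply] at hi
  rw [← hσ (x i), hi, map_zero]
  rfl

/-- Members of `U(J)` act by isometries of `B_J`. [folklore] -/
private theorem isometry_of_mem (J : Matrix n n K) (g : ↥(unitaryGroupOfForm σ J)) (x y : n → K) :
    Matrix.toLinearMapₛₗ₂' K σ (RingHom.id K) J (Matrix.toLin' g.1.1 x) (Matrix.toLin' g.1.1 y) =
      Matrix.toLinearMapₛₗ₂' K σ (RingHom.id K) J x y := by
  rw [form_toLin', mem_unitaryGroupOfForm_iff.1 g.2, ← toLinearMapₛₗ₂'_apply_eq]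

/-- **Representatives**: an `End`-level isometry of `B_J` (`det J ≠ 0`) is `Matrix.toLin'` of a member of `U(J)`.
[folklore] -/
private theorem exists_toLin'_eq (J : Matrix n n K) (hJdet : J.det ≠ 0) (φ : Module.End K (n → K))
    (hφ : ∀ x y, Matrix.toLinearMapₛₗ₂' K σ (RingHom.id K) J (φ x) (φ y) =
      Matrix.toLinearMapₛₗ₂' K σ (RingHom.id K) J x y) :
    ∃ g : ↥(unitaryGroupOfForm σ J), Matrix.toLin' g.1.1 = φ := by
  have hmem_of_iso : ∀ M : Matrix n n K, (∀ x y, Matrix.toLinearMapₛₗ₂' K σ (RingHom.id K) J (Matrix.toLin' M x)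
      (Matrix.toLin' M y) = Matrix.toLinearMapₛₗ₂' K σ (RingHom.id K) J x y) → (M.map σ).transpose * J * M = J := by
    intro M hM
    ext i j
    have h := hM (Pi.single i 1) (Pi.single j 1)
    rw [form_toLin', toLinearMapₛₗ₂'_apply_eq, sigma_single, single_dotProduct, single_dotProduct, one_mul,
      one_mul, Matrix.mulVec_single_one, Matrix.mulVec_single_one, Matrix.col_apply, Matrix.col_apply] at h
    exact h
  have hM : ((LinearMap.toMatrix' φ).map σ).transpose * J * LinearMap.toMatrix' φ = J :=
    hmem_of_iso _ (by rw [Matrix.toLin'_toMatrix']; exact hφ)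
  have hdetM : (LinearMap.toMatrix' φ).det ≠ 0 := by
    intro hM0
    have h := congrArg Matrix.det hM
    rw [Matrix.det_mul, Matrix.det_mul, hM0, mul_zero] at h
    exact hJdet h.symm
  refine ⟨⟨Matrix.GeneralLinearGroup.mkOfDetNeZero _ hdetM, ?_⟩, ?_⟩
  · rw [mem_unitaryGroupOfForm_iff, Matrix.GeneralLinearGroup.val_mkOfDetNeZero]; exact hM
  · change Matrix.toLin' ((Matrix.GeneralLinearGroup.mkOfDetNeZero _ hdetM : Matrix n n K)) = φ
    rw [Matrix.GeneralLinearGroup.val_mkOfDetNeZero, Matrix.toLin'_toMatrix']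

/-! ## §3 `det : U(J) → N¹(σ)` is onto for every non-degenerate hermitian `J` (quasi-symmetries) -/

/-- **`det : U(J) → N¹(σ) = {u : σ u · u = 1}` is ONTO** for EVERY non-degenerate `σ`-hermitian `J` of non-zero size over a
field with `2 ≠ 0` and an involution `σ` with `σ θ₀ = −θ₀ ≠ 0` — isotropic or not: the quasi-symmetry `Q(a, u)` along an
anisotropic vector `a` of `(Kⁿ, B_J)` is an isometry of determinant `u`. [cite: Dieudonne1971GroupesClassiques, Chap. II §§4–5] -/
theorem exists_det_eq [Nonempty n] (hσ : ∀ x : K, σ (σ x) = x) {θ₀ : K} (hθ : σ θ₀ = -θ₀) (hθ0 : θ₀ ≠ 0)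
    (h2 : (2 : K) ≠ 0) (J : Matrix n n K) (hJh : (J.map σ).transpose = J) (hJdet : J.det ≠ 0) (u : K)
    (hu : σ u * u = 1) : ∃ g : ↥(unitaryGroupOfForm σ J), g.1.1.det = u := by
  classical
  obtain ⟨B, hBdef⟩ : ∃ B, B = Matrix.toLinearMapₛₗ₂' K σ (RingHom.id K) J := ⟨_, rfl⟩
  have hB : ∀ x y, σ (B x y) = B y x := by subst hBdef; exact form_hermitian hσ J hJh
  have hBnd : ∀ x, (∀ y, B x y = 0) → x = 0 := by subst hBdef; exact form_nondegenerate hσ J hJdet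
  obtain ⟨i⟩ := ‹Nonempty n›
  have hne : ∃ w : n → K, w ≠ 0 := by
    refine ⟨Pi.single i (1 : K), fun h => ?_⟩
    have h1 : Pi.single (M := fun _ => K) i (1 : K) i = 0 := by rw [h]; rfl
    rw [Pi.single_eq_same] at h1
    exact one_ne_zero h1
  obtain ⟨a, ha⟩ := exists_anisotropic B hB hBnd hθ hθ0 h2 hne
  obtain ⟨g, hg⟩ := exists_toLin'_eq J hJdet
    ((1 : Module.End K (n → K)) + ((u - 1) * (B a a)⁻¹) • (B a).smulRight a)
    (by subst hBdef; exact quasi_isometry _ hB a ha u hu)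
  refine ⟨g, ?_⟩
  rw [← LinearMap.det_toLin', hg, det_quasi B a ha u]

/-- Unit form: every `u ∈ Kˣ` with `σ u · u = 1` is `Matrix.GeneralLinearGroup.det g` for some `g ∈ U(J)`.
[cite: Dieudonne1971GroupesClassiques, Chap. II §§4–5] -/
theorem exists_det_eq_units [Nonempty n] (hσ : ∀ x : K, σ (σ x) = x) {θ₀ : K} (hθ : σ θ₀ = -θ₀) (hθ0 : θ₀ ≠ 0)
    (h2 : (2 : K) ≠ 0) (J : Matrix n n K) (hJh : (J.map σ).transpose = J) (hJdet : J.det ≠ 0) (u : Kˣ)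
    (hu : σ (u : K) * u = 1) : ∃ g : ↥(unitaryGroupOfForm σ J), Matrix.GeneralLinearGroup.det g.1 = u := by
  obtain ⟨g, hg⟩ := exists_det_eq hσ hθ hθ0 h2 J hJh hJdet (u : K) hu
  exact ⟨g, Units.ext (by rw [Matrix.GeneralLinearGroup.val_det_apply]; exact hg)⟩

/-- **The range of `det : U(J) →* Kˣ` is EXACTLY `N¹(σ)`**: `u = det g` for some `g ∈ U(J)` iff `σ u · u = 1`
(non-degenerate hermitian `J` of non-zero size). [cite: Dieudonne1971GroupesClassiques, Chap. II §5] -/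
theorem mem_range_det_iff [Nonempty n] (hσ : ∀ x : K, σ (σ x) = x) {θ₀ : K} (hθ : σ θ₀ = -θ₀) (hθ0 : θ₀ ≠ 0)
    (h2 : (2 : K) ≠ 0) (J : Matrix n n K) (hJh : (J.map σ).transpose = J) (hJdet : J.det ≠ 0) (u : Kˣ) :
    u ∈ (Matrix.GeneralLinearGroup.det.comp (unitaryGroupOfForm σ J).subtype).range ↔ σ (u : K) * u = 1 := by
  constructor
  · rintro ⟨g, rfl⟩
    rw [MonoidHom.comp_apply, Subgroup.subtype_apply]
    exact sigma_det_mul_det_units J hJdet g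
  · intro hu
    obtain ⟨g, hg⟩ := exists_det_eq_units hσ hθ hθ0 h2 J hJh hJdet u hu
    exact ⟨g, by rw [MonoidHom.comp_apply, Subgroup.subtype_apply]; exact hg⟩

/-- **`det(U(J)) = N¹(σ)` as subgroups of `Kˣ`**: the range of `det : U(J) →* Kˣ` is the kernel of the `σ`-norm
homomorphism `u ↦ σ(u) · u` of `Kˣ` (non-degenerate hermitian `J` of non-zero size).
[cite: Dieudonne1971GroupesClassiques, Chap. II §5] -/
theorem range_det_eq_ker_norm [Nonempty n] (hσ : ∀ x : K, σ (σ x) = x) {θ₀ : K} (hθ : σ θ₀ = -θ₀) (hθ0 : θ₀ ≠ 0)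
    (h2 : (2 : K) ≠ 0) (J : Matrix n n K) (hJh : (J.map σ).transpose = J) (hJdet : J.det ≠ 0) :
    (Matrix.GeneralLinearGroup.det.comp (unitaryGroupOfForm σ J).subtype).range =
      (Units.map (σ : K →* K) * MonoidHom.id Kˣ).ker := by
  ext u
  rw [mem_range_det_iff hσ hθ hθ0 h2 J hJh hJdet u, MonoidHom.mem_ker, MonoidHom.mul_apply, MonoidHom.id_apply,
    ← Units.val_eq_one, Units.val_mul, Units.coe_map, MonoidHom.coe_coe]

/-! ## §4 `U(J)′ = SU(J)`: the commutator subgroup of an isotropic unitary group is the determinant-one subgroup -/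

/-- **`U(J)′ = SU(J)`.**  For a field `K` with `2 ≠ 0`, an involution `σ` with `σ θ₀ = −θ₀ ≠ 0`, and a non-degenerate
`σ`-hermitian `J` of any finite size admitting an ISOTROPIC vector, the commutator subgroup of `U(J) = unitaryGroupOfForm σ J`
is the kernel of `det : U(J) →* Kˣ`.  (`≤`: `Kˣ` is commutative; `≥`: the engine ✔ `apply_eq_one_of_det_eq_one` applied to the
canonical map `U(J) →* U(J)^{ab}`, whose kernel is the commutator subgroup.) [cite: Dieudonne1971GroupesClassiques, Chap. II §5] -/
theorem commutator_eq_ker_det (hσ : ∀ x : K, σ (σ x) = x) {θ₀ : K} (hθ : σ θ₀ = -θ₀) (hθ0 : θ₀ ≠ 0)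
    (h2 : (2 : K) ≠ 0) (J : Matrix n n K) (hJh : (J.map σ).transpose = J) (hJdet : J.det ≠ 0)
    (hiso : ∃ x : n → K, x ≠ 0 ∧ dotProduct (fun i => σ (x i)) (J.mulVec x) = 0) :
    commutator ↥(unitaryGroupOfForm σ J) = (Matrix.GeneralLinearGroup.det.comp (unitaryGroupOfForm σ J).subtype).ker := by
  refine le_antisymm (Abelianization.commutator_subset_ker _) fun g hg => ?_
  rw [MonoidHom.mem_ker, MonoidHom.comp_apply, Subgroup.subtype_apply] at hg
  have hdet : g.1.1.det = 1 := by
    rw [← Matrix.GeneralLinearGroup.val_det_apply, hg, Units.val_one]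
  have key := apply_eq_one_of_det_eq_one hσ hθ hθ0 h2 J hJh hJdet hiso Abelianization.of g hdet
  rwa [← MonoidHom.mem_ker, Abelianization.ker_of] at key

/-- **Membership form: `g ∈ U(J)′ ↔ det g = 1`** (isotropic non-degenerate hermitian `J`).
[cite: Dieudonne1971GroupesClassiques, Chap. II §5] -/
theorem mem_commutator_iff_det_eq_one (hσ : ∀ x : K, σ (σ x) = x) {θ₀ : K} (hθ : σ θ₀ = -θ₀) (hθ0 : θ₀ ≠ 0)
    (h2 : (2 : K) ≠ 0) (J : Matrix n n K) (hJh : (J.map σ).transpose = J) (hJdet : J.det ≠ 0)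
    (hiso : ∃ x : n → K, x ≠ 0 ∧ dotProduct (fun i => σ (x i)) (J.mulVec x) = 0) (g : ↥(unitaryGroupOfForm σ J)) :
    g ∈ commutator ↥(unitaryGroupOfForm σ J) ↔ g.1.1.det = 1 := by
  rw [commutator_eq_ker_det hσ hθ hθ0 h2 J hJh hJdet hiso, MonoidHom.mem_ker, MonoidHom.comp_apply, Subgroup.subtype_apply,
    ← Matrix.GeneralLinearGroup.val_det_apply, Units.val_eq_one]

/-- **Every element of determinant one is a product of commutators of `U(J)`** (the direction `SU(J) ≤ U(J)′`).
[cite: Dieudonne1971GroupesClassiques, Chap. II §5] -/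
theorem mem_commutator_of_det_eq_one (hσ : ∀ x : K, σ (σ x) = x) {θ₀ : K} (hθ : σ θ₀ = -θ₀) (hθ0 : θ₀ ≠ 0)
    (h2 : (2 : K) ≠ 0) (J : Matrix n n K) (hJh : (J.map σ).transpose = J) (hJdet : J.det ≠ 0)
    (hiso : ∃ x : n → K, x ≠ 0 ∧ dotProduct (fun i => σ (x i)) (J.mulVec x) = 0) (g : ↥(unitaryGroupOfForm σ J))
    (hdet : g.1.1.det = 1) : g ∈ commutator ↥(unitaryGroupOfForm σ J) :=
  (mem_commutator_iff_det_eq_one hσ hθ hθ0 h2 J hJh hJdet hiso g).2 hdet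

/-! ## §5 Characters: dependence on `det` only, unique factorisation through `det`, `U(J)^{ab} ≅ N¹(σ)` -/

/-- **A homomorphism `U(J) →* A` to a commutative group depends on `det` only**: `det g = det h ⟹ χ g = χ h`
(isotropic non-degenerate hermitian `J`). [cite: Dieudonne1971GroupesClassiques, Chap. II §5] -/
theorem apply_eq_of_det_eq {A : Type*} [CommGroup A] (hσ : ∀ x : K, σ (σ x) = x) {θ₀ : K} (hθ : σ θ₀ = -θ₀)
    (hθ0 : θ₀ ≠ 0) (h2 : (2 : K) ≠ 0) (J : Matrix n n K) (hJh : (J.map σ).transpose = J) (hJdet : J.det ≠ 0)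
    (hiso : ∃ x : n → K, x ≠ 0 ∧ dotProduct (fun i => σ (x i)) (J.mulVec x) = 0)
    (χ : ↥(unitaryGroupOfForm σ J) →* A) (g h : ↥(unitaryGroupOfForm σ J)) (hgh : g.1.1.det = h.1.1.det) :
    χ g = χ h := by
  have hu : Matrix.GeneralLinearGroup.det g.1 = Matrix.GeneralLinearGroup.det h.1 :=
    Units.ext (by rw [Matrix.GeneralLinearGroup.val_det_apply, Matrix.GeneralLinearGroup.val_det_apply]; exact hgh)
  have hdet : (g * h⁻¹).1.1.det = 1 := by
    rw [← Matrix.GeneralLinearGroup.val_det_apply, Units.val_eq_one]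
    change Matrix.GeneralLinearGroup.det (g.1 * h.1⁻¹) = 1
    rw [map_mul, map_inv, hu, mul_inv_cancel]
  have key := apply_eq_one_of_det_eq_one hσ hθ hθ0 h2 J hJh hJdet hiso χ (g * h⁻¹) hdet
  rwa [map_mul, map_inv, mul_inv_eq_one] at key

/-- **Unique factorisation through `det`**: every homomorphism `χ : U(J) →* A` to a commutative group is `ψ ∘ det` for a
UNIQUE homomorphism `ψ` on the determinant group `det(U(J)) ≤ Kˣ` (`= N¹(σ)` by `mem_range_det_iff`) — characters of `U(J)`
«are» characters of `N¹(σ)` (isotropic non-degenerate hermitian `J`). [cite: Dieudonne1971GroupesClassiques, Chap. II §5] -/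
theorem existsUnique_eq_comp_rangeRestrict_det {A : Type*} [CommGroup A] (hσ : ∀ x : K, σ (σ x) = x) {θ₀ : K}
    (hθ : σ θ₀ = -θ₀) (hθ0 : θ₀ ≠ 0) (h2 : (2 : K) ≠ 0) (J : Matrix n n K) (hJh : (J.map σ).transpose = J)
    (hJdet : J.det ≠ 0) (hiso : ∃ x : n → K, x ≠ 0 ∧ dotProduct (fun i => σ (x i)) (J.mulVec x) = 0)
    (χ : ↥(unitaryGroupOfForm σ J) →* A) :
    ∃! ψ : ↥(Matrix.GeneralLinearGroup.det.comp (unitaryGroupOfForm σ J).subtype).range →* A,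
      χ = ψ.comp (Matrix.GeneralLinearGroup.det.comp (unitaryGroupOfForm σ J).subtype).rangeRestrict := by
  obtain ⟨δ, hδ⟩ : ∃ δ, δ = Matrix.GeneralLinearGroup.det.comp (unitaryGroupOfForm σ J).subtype := ⟨_, rfl⟩
  have hsurj : Function.Surjective δ.rangeRestrict := MonoidHom.rangeRestrict_surjective δ
  have hker : δ.rangeRestrict.ker ≤ χ.ker := by
    rw [MonoidHom.ker_rangeRestrict, hδ, ← commutator_eq_ker_det hσ hθ hθ0 h2 J hJh hJdet hiso]
    exact Abelianization.commutator_subset_ker χ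
  subst hδ
  refine ⟨MonoidHom.liftOfSurjective _ hsurj ⟨χ, hker⟩, ?_, ?_⟩
  · exact (MonoidHom.liftOfRightInverse_comp _ _ _ ⟨χ, hker⟩).symm
  · intro ψ hψ
    ext y
    obtain ⟨g, rfl⟩ := hsurj y
    rw [MonoidHom.liftOfRightInverse_comp_apply]
    exact (congrArg (fun φ : ↥(unitaryGroupOfForm σ J) →* A => φ g) hψ).symm

/-- **`U(J)^{ab} ≅ N¹(σ)`**: the homomorphism `U(J)^{ab} → det(U(J))`, `[g] ↦ det g` (`Abelianization.lift` of
`det : U(J) ↠ det(U(J))`, the latter `= N¹(σ)` by `mem_range_det_iff`) is BIJECTIVE (isotropic non-degenerate hermitian `J`).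
[cite: Dieudonne1971GroupesClassiques, Chap. II §5] -/
theorem bijective_abelianizationLift_det (hσ : ∀ x : K, σ (σ x) = x) {θ₀ : K} (hθ : σ θ₀ = -θ₀) (hθ0 : θ₀ ≠ 0)
    (h2 : (2 : K) ≠ 0) (J : Matrix n n K) (hJh : (J.map σ).transpose = J) (hJdet : J.det ≠ 0)
    (hiso : ∃ x : n → K, x ≠ 0 ∧ dotProduct (fun i => σ (x i)) (J.mulVec x) = 0) :
    Function.Bijective
      (Abelianization.lift (Matrix.GeneralLinearGroup.det.comp (unitaryGroupOfForm σ J).subtype).rangeRestrict) := by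
  obtain ⟨δ, hδ⟩ : ∃ δ, δ = Matrix.GeneralLinearGroup.det.comp (unitaryGroupOfForm σ J).subtype := ⟨_, rfl⟩
  have hkerδ : δ.ker = commutator ↥(unitaryGroupOfForm σ J) := by
    rw [hδ, commutator_eq_ker_det hσ hθ hθ0 h2 J hJh hJdet hiso]
  rw [← hδ]
  have hofs : Function.Surjective (Abelianization.of : ↥(unitaryGroupOfForm σ J) →* Abelianization ↥(unitaryGroupOfForm σ J)) :=
    fun x => QuotientGroup.induction_on x fun g => ⟨g, rfl⟩
  constructor
  · rw [← MonoidHom.ker_eq_bot_iff, eq_bot_iff]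
    intro x hx
    obtain ⟨g, rfl⟩ := hofs x
    rw [MonoidHom.mem_ker, Abelianization.lift_apply_of] at hx
    have hg : g ∈ δ.ker := by
      rw [← MonoidHom.ker_rangeRestrict, MonoidHom.mem_ker]; exact hx
    rw [hkerδ, ← Abelianization.ker_of] at hg
    rw [Subgroup.mem_bot]
    exact (MonoidHom.mem_ker).1 hg
  · intro y
    obtain ⟨g, rfl⟩ := MonoidHom.rangeRestrict_surjective δ y
    exact ⟨Abelianization.of g, Abelianization.lift_apply_of _ _⟩

/-! ## §6 Hypothesis forms for a matrix `M` propositionally equal to `J` (the tree's local unitary groups) -/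

/-- Hypothesis form of `exists_det_eq` for `M = J`. [cite: Dieudonne1971GroupesClassiques, Chap. II §§4–5] -/
theorem exists_det_eq' [Nonempty n] (hσ : ∀ x : K, σ (σ x) = x) {θ₀ : K} (hθ : σ θ₀ = -θ₀) (hθ0 : θ₀ ≠ 0)
    (h2 : (2 : K) ≠ 0) (M J : Matrix n n K) (hM : M = J) (hJh : (J.map σ).transpose = J) (hJdet : J.det ≠ 0) (u : K)
    (hu : σ u * u = 1) : ∃ g : ↥(unitaryGroupOfForm σ M), g.1.1.det = u := by
  subst hM
  exact exists_det_eq hσ hθ hθ0 h2 M hJh hJdet u hu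

/-- Hypothesis form of `commutator_eq_ker_det` for `M = J`. [cite: Dieudonne1971GroupesClassiques, Chap. II §5] -/
theorem commutator_eq_ker_det' (hσ : ∀ x : K, σ (σ x) = x) {θ₀ : K} (hθ : σ θ₀ = -θ₀) (hθ0 : θ₀ ≠ 0)
    (h2 : (2 : K) ≠ 0) (M J : Matrix n n K) (hM : M = J) (hJh : (J.map σ).transpose = J) (hJdet : J.det ≠ 0)
    (hiso : ∃ x : n → K, x ≠ 0 ∧ dotProduct (fun i => σ (x i)) (J.mulVec x) = 0) :
    commutator ↥(unitaryGroupOfForm σ M) = (Matrix.GeneralLinearGroup.det.comp (unitaryGroupOfForm σ M).subtype).ker := by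
  subst hM
  exact commutator_eq_ker_det hσ hθ hθ0 h2 M hJh hJdet hiso

/-- Hypothesis form of `mem_commutator_iff_det_eq_one` for `M = J`. [cite: Dieudonne1971GroupesClassiques, Chap. II §5] -/
theorem mem_commutator_iff_det_eq_one' (hσ : ∀ x : K, σ (σ x) = x) {θ₀ : K} (hθ : σ θ₀ = -θ₀) (hθ0 : θ₀ ≠ 0)
    (h2 : (2 : K) ≠ 0) (M J : Matrix n n K) (hM : M = J) (hJh : (J.map σ).transpose = J) (hJdet : J.det ≠ 0)
    (hiso : ∃ x : n → K, x ≠ 0 ∧ dotProduct (fun i => σ (x i)) (J.mulVec x) = 0) (g : ↥(unitaryGroupOfForm σ M)) :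
    g ∈ commutator ↥(unitaryGroupOfForm σ M) ↔ g.1.1.det = 1 := by
  subst hM
  exact mem_commutator_iff_det_eq_one hσ hθ hθ0 h2 M hJh hJdet hiso g

/-- Hypothesis form of `apply_eq_of_det_eq` for `M = J`. [cite: Dieudonne1971GroupesClassiques, Chap. II §5] -/
theorem apply_eq_of_det_eq' {A : Type*} [CommGroup A] (hσ : ∀ x : K, σ (σ x) = x) {θ₀ : K} (hθ : σ θ₀ = -θ₀)
    (hθ0 : θ₀ ≠ 0) (h2 : (2 : K) ≠ 0) (M J : Matrix n n K) (hM : M = J) (hJh : (J.map σ).transpose = J)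
    (hJdet : J.det ≠ 0) (hiso : ∃ x : n → K, x ≠ 0 ∧ dotProduct (fun i => σ (x i)) (J.mulVec x) = 0)
    (χ : ↥(unitaryGroupOfForm σ M) →* A) (g h : ↥(unitaryGroupOfForm σ M)) (hgh : g.1.1.det = h.1.1.det) :
    χ g = χ h := by
  subst hM
  exact apply_eq_of_det_eq hσ hθ hθ0 h2 M hJh hJdet hiso χ g h hgh

/-- Hypothesis form of `existsUnique_eq_comp_rangeRestrict_det` for `M = J`.
[cite: Dieudonne1971GroupesClassiques, Chap. II §5] -/
theorem existsUnique_eq_comp_rangeRestrict_det' {A : Type*} [CommGroup A] (hσ : ∀ x : K, σ (σ x) = x) {θ₀ : K}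
    (hθ : σ θ₀ = -θ₀) (hθ0 : θ₀ ≠ 0) (h2 : (2 : K) ≠ 0) (M J : Matrix n n K) (hM : M = J)
    (hJh : (J.map σ).transpose = J) (hJdet : J.det ≠ 0)
    (hiso : ∃ x : n → K, x ≠ 0 ∧ dotProduct (fun i => σ (x i)) (J.mulVec x) = 0)
    (χ : ↥(unitaryGroupOfForm σ M) →* A) :
    ∃! ψ : ↥(Matrix.GeneralLinearGroup.det.comp (unitaryGroupOfForm σ M).subtype).range →* A,
      χ = ψ.comp (Matrix.GeneralLinearGroup.det.comp (unitaryGroupOfForm σ M).subtype).rangeRestrict := by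
  subst hM
  exact existsUnique_eq_comp_rangeRestrict_det hσ hθ hθ0 h2 M hJh hJdet hiso χ

end MatrixForm

end UnitaryIsotropic

end Literature.NumberTheory.Automorphic
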